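import Summits.BirchSwinnertonDyer.Rank1Residual.Supersingular.SignedRankOneCorA5
import Literature.NumberTheory.EllipticCurves.Rank1Residual.Typed.X8
import HarnessLib

/-!
# The good-supersingular axis at an odd prime in ONE kernel statement: `BSD(E,p)` for `r_an ≤ 1` from
# named published facts + EXACTLY the typed signed inputs (RESIDUAL-MAP §B; coordinator ruling (A) of
# 2026-08-20, "one assembled kernel statement with explicit corner predicates") — cell `b2b-bsdres`,
# supersingular family, prover B = unit `b2b-bsdres-additive-p3`, gen 13 (X7 joint with prover A)

HONEST FRAMING (run/shared/lean/b2b/bsd-rank1-residual/, verbatim in every file): the goal of the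
cell is to DELETE the COMBINATION-SHAPED residual classes of the Birch–Swinnerton-Dyer formula for
ALL analytic-rank `≤ 1` elliptic curves over `ℚ` — "full BSD formula for every rank `≤ 1` curve in
class `C`" assembled STRICTLY from published theorems — so that the rank-`≤ 1` remainder becomes
exactly the CONSTRUCTION-SHAPED classes, which are TYPED (missing-input `Prop`s), NOT attempted.
This is not "finishing BSD". The WHOLE good-supersingular axis at odd `p` is corner for the strong
partial theorem except its JSW sub-cell (RESIDUAL-MAP §B CORNER_B: `r = 0 ∨ ¬sst ∨ (p = 3 ∧ a_3 ≠ 0)`;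
the complement `r = 1 ∧ sst ∧ (p ≥ 5 ∨ a_3 = 0)` = JSW 2017 Thm. 1.2.1-ss, `[PUB*]` flag `JSW-ss`).
This file states, for the glue seat's assembly, WHAT the corner costs in typed inputs — nothing is
asserted about any curve, no label moves (X6/X7/X8 CONSTRUCTION-SHAPED), nothing is booked. Theorems
only (pure compositions of landed theorems); no definition; no new named fact.

## The statement (odd prime `p` of good supersingular reduction, `W` globally minimal, `r_an ≤ 1`)

* `a_p = 0` (classes X6 ∪ X7 ∩ {a_3 = 0}; automatic for `p ≥ 5` by Hasse):
  `bsdp_of_goodSS_apZero_of_signedInputs_of_analyticRank_le_one` — `BSD(E,p)` ⇐ named facts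
  (Wuthrich 2014 Prop. 21 `hW`, Kobayashi 2003 Thm. 1.2 `h12` = A94, B. D. Kim 2013 Cor. 3.15 `hKim`,
  Pollack `hPollack`, modularity `hmod`/`hmod'`, GZK `hGZK`, the Burungale–Kobayashi–Ota Cor. A.5
  reading-fact `hA5` = p239835) + EXACTLY these typed inputs:
  - `r_an = 0 ∧ surj(p)`: `KobayashiLowerDivisibility W p ε` for ONE sign (prover A's typed Eisenstein
    half, p209365; class-agnostic chain `missingLowerBoundAt_of_kobayashiLowerDivisibility` + Wuthrich);
  - `r_an = 0 ∧ ¬surj(p)` (X7's small-image pairs, e.g. `3Nn`/`5Ns`): the whole typed output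
    `MissingPPartAt W p` (no Kato-side upper bound in print without big image);
  - `r_an = 1`: `KobayashiMainConjecture W p ε` for ONE sign (gen 13, `SignedRankOneCorA5.lean`:
    Cor. A.5 ∘ Kobayashi Thm. 7.4; NO image hypothesis).
* `p = 3`, `a_3 = ±3` (class X8, Sprung's ♯/♭ side): the typed residue `Typed.X8.MissingInputAt W 3`
  (r = 0 ∧ surj(3): the ♯/♭ lower bound `MissingLowerBoundAt`; otherwise the whole output; X8 ⇒ irr(3),
  so the Borel branch is empty) — `Typed.X8.bsdp_of_missingInputAt` (Literature, typed file of record).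
* The two glued: `bsdp_of_goodSS_of_typedInputs_of_analyticRank_le_one` (any odd good supersingular
  `p`): the §B block of RESIDUAL-MAP as a single implication "named facts + typed inputs ⇒ BSD(E,p)".
  `p ≥ 5` form without the X8 branch: `bsdp_of_goodSS_of_five_le_of_signedInputs_of_analyticRank_le_one`.

PER PAIR each typed input above has certificate-fed dischargers in the tree (rank 1:
`SqueezeCertificates` p214698 + `SignedRankOneCorA5`; rank 0: the converse/exact forms
`KobayashiConverseReal` p213380, descent records) — not restated here.

References: [Wuthrich2014] Prop. 21 (p. 400); [Kobayashi2003] Thm. 1.2, Thm. 7.4, Conjecture (p. 2);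
[BDKim2013] Cor. 3.15; [Pollack2003] Thm. 5.6, Prop. 6.18; [BurungaleKobayashiOta2023] App. A Cor. A.5;
[Serre1972] §1.11 Prop. 12; [Serre1981] §8 (Hasse bound); [Miller2011LMS] §1, Def. 1.1; [Darmon2004]
Thm. 3.22; [JetchevSkinnerWan2017] Thm. 1.2.1 (the complement, not used).
-/

set_option autoImplicit false

noncomputable section

open scoped Classical MatrixGroups ModularForm

open CongruenceSubgroup WeierstrassCurve Literature.NumberTheory.EllipticCurves
  Literature.NumberTheory.EllipticCurves.ModularForms
  Literature.NumberTheory.EllipticCurves.Rank1Residual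
  Literature.NumberTheory.EllipticCurves.Rank1Residual.Typed
  Literature.NumberTheory.EllipticCurves.Kobayashi2003
  Literature.NumberTheory.EllipticCurves.BurungaleKobayashiOta2024 ZpExtension

namespace Summit.BirchSwinnertonDyer.Rank1Residual.Supersingular

variable (W : WeierstrassCurve ℚ) [W.IsElliptic] [W.IsGloballyMinimal] (p : ℕ) [Fact p.Prime]

/-- **The `a_p = 0` good-supersingular axis at an odd prime, `r_an ≤ 1`: `BSD(E,p)` ⇐ named facts +
the typed signed inputs.** Named facts: Wuthrich 2014 Prop. 21 (`hW`), Kobayashi 2003 Thm. 1.2 (`h12`),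
B. D. Kim 2013 Cor. 3.15 (`hKim`), Pollack's `L^±` (`hPollack`), modularity (`hmod`, `hmod'`), GZK
(`hGZK`), the Burungale–Kobayashi–Ota Cor. A.5 reading-fact (`hA5`). Typed inputs, by rank and image:
`r_an = 0 ∧ surj(p)` — `KobayashiLowerDivisibility W p ε` for one sign (`h0`); `r_an = 0 ∧ ¬surj(p)`
— the whole output `MissingPPartAt W p` (`h0'`); `r_an = 1` — `KobayashiMainConjecture W p ε` for one
sign (`h1`). Irreducibility of `E[p]` is automatic (odd supersingular `p`, Serre Prop. 12). Pure
composition of `missingLowerBoundAt_of_kobayashiLowerDivisibility` (prover A),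
`bsdp_of_missingLowerBoundAt_of_wuthrich`, `bsdp_of_missingPPartAt` and
`bsdp_of_kobayashiMainConjecture_of_corA5_of_analyticRank_eq_one`. Nothing asserted beyond the binders.
[cite: Wuthrich2014, Prop. 21 (p. 400)] [cite: Kobayashi2003, Thm. 1.2, Thm. 7.4 and Conjecture (p. 2)]
[cite: BDKim2013, Cor. 3.15 (p. 199)] [cite: BurungaleKobayashiOta2023, App. A Cor. A.5]
[cite: Serre1972, §1.11 Prop. 12] [cite: Miller2011LMS, §1 and Def. 1.1] -/
theorem bsdp_of_goodSS_apZero_of_signedInputs_of_analyticRank_le_one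
    (hW : Wuthrich2014.sha_dvd_analyticSha)
    (h12 : Kobayashi2003.thm12_signedSelmerDual_finite_torsion)
    (hKim : BDKim2013.cor315_signedCharValue_rankZero)
    (hPollack : ∀ {N : ℕ} [NeZero N] {f : CuspForm (Gamma0 N) 2},
      pollack_exists_plusMinusPAdicLFunction (W := W) (f := f) (p := p))
    (hmod : nonempty_modularParametrizationData) (hmod' : hasEntireLFunction_rat)
    (hGZK : rank_eq_analyticRank_of_analyticRank_le_one)
    (hA5 : corA5_pPart_of_signedCharIdeal_eq)
    (hp : p ≠ 2) (hgood : W.HasGoodReductionAtPrime p) (hap : W.frobeniusTrace p = 0)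
    (hr : W.analyticRank ≤ 1)
    (h0 : W.analyticRank = 0 → Surj W p → ∃ ε : ℤˣ, KobayashiLowerDivisibility W p ε)
    (h0' : W.analyticRank = 0 → ¬ Surj W p → MissingPPartAt W p)
    (h1 : W.analyticRank = 1 → ∃ ε : ℤˣ, KobayashiMainConjecture W p ε) : BSDp W p := by
  rcases Nat.le_one_iff_eq_zero_or_eq_one.mp hr with hr0 | hr1
  · by_cases hs : Surj W p
    · obtain ⟨ε, hdiv⟩ := h0 hr0 hs
      have hirr : W.HasIrreducibleModPGaloisRep p :=
        hasIrreducibleModPGaloisRep_of_dvd_frobeniusTrace W p hp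
          (W.not_dvd_minimalDiscriminantInt_of_hasGoodReductionAtPrime' p hgood)
          (by rw [hap]; exact dvd_zero _)
      have hL : W.entireLFunction 1 ≠ 0 := (W.analyticRank_eq_zero_iff_holds (hmod' W)).1 hr0
      have hadd : ¬ ((W.baseChange ℚ_[p]).minimal ℤ_[p]).HasAdditiveReduction ℤ_[p] :=
        WeierstrassCurve.HasGoodReduction.not_hasAdditiveReduction (R := ℤ_[p]) hgood
      exact bsdp_of_missingLowerBoundAt_of_wuthrich W p hW hGZK hmod' hp hr0 hadd (Or.inr hs)
        (missingLowerBoundAt_of_kobayashiLowerDivisibility W p h12 hKim hPollack hmod hGZK hp hgood hap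
          hirr hL hdiv)
    · exact bsdp_of_missingPPartAt W p hGZK hr (h0' hr0 hs)
  · obtain ⟨ε, hMC⟩ := h1 hr1
    exact bsdp_of_kobayashiMainConjecture_of_corA5_of_analyticRank_eq_one W p hA5 hmod' hGZK hp hgood hap
      hr1 ε hMC

/-- **Good supersingular `p ≥ 5`, `r_an ≤ 1`: `BSD(E,p)` ⇐ named facts + the typed signed inputs**
(`a_p = 0` by Hasse from `p ∣ a_p`, `natCast_dvd_frobeniusTrace_iff_eq_zero`; classes X6 ∪ X7 at
`p ≥ 5`). [cite: Serre1981, §8.1–8.2 (pp. 188–189)] [cite: Kobayashi2003, Thm. 1.2, Thm. 7.4 and Conjecture (p. 2)]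
[cite: Wuthrich2014, Prop. 21 (p. 400)] [cite: BurungaleKobayashiOta2023, App. A Cor. A.5] -/
theorem bsdp_of_goodSS_of_five_le_of_signedInputs_of_analyticRank_le_one
    (hW : Wuthrich2014.sha_dvd_analyticSha)
    (h12 : Kobayashi2003.thm12_signedSelmerDual_finite_torsion)
    (hKim : BDKim2013.cor315_signedCharValue_rankZero)
    (hPollack : ∀ {N : ℕ} [NeZero N] {f : CuspForm (Gamma0 N) 2},
      pollack_exists_plusMinusPAdicLFunction (W := W) (f := f) (p := p))
    (hmod : nonempty_modularParametrizationData) (hmod' : hasEntireLFunction_rat)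
    (hGZK : rank_eq_analyticRank_of_analyticRank_le_one)
    (hA5 : corA5_pPart_of_signedCharIdeal_eq)
    (hp5 : 5 ≤ p) (hss : GoodSS W p) (hr : W.analyticRank ≤ 1)
    (h0 : W.analyticRank = 0 → Surj W p → ∃ ε : ℤˣ, KobayashiLowerDivisibility W p ε)
    (h0' : W.analyticRank = 0 → ¬ Surj W p → MissingPPartAt W p)
    (h1 : W.analyticRank = 1 → ∃ ε : ℤˣ, KobayashiMainConjecture W p ε) : BSDp W p :=
  bsdp_of_goodSS_apZero_of_signedInputs_of_analyticRank_le_one W p hW h12 hKim hPollack hmod hmod' hGZK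
    hA5 (by omega) hss.1 ((W.natCast_dvd_frobeniusTrace_iff_eq_zero p hp5 hss.1).mp hss.2) hr h0 h0' h1

/-- **THE GOOD-SUPERSINGULAR AXIS AT AN ODD PRIME (RESIDUAL-MAP §B), `r_an ≤ 1`, in one implication**:
for `W/ℚ` globally minimal and an odd prime `p` of good supersingular reduction, `BSD(E,p)` follows
from the named published facts (`hW`, `h12`, `hKim`, `hPollack`, `hmod`, `hmod'`, `hGZK`, `hA5`) and
EXACTLY these typed inputs: if `a_p = 0` (X6 ∪ X7; automatic for `p ≥ 5`) — `r_an = 0 ∧ surj(p)`: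
`KobayashiLowerDivisibility W p ε` for one sign; `r_an = 0 ∧ ¬surj(p)`: `MissingPPartAt W p`;
`r_an = 1`: `KobayashiMainConjecture W p ε` for one sign —; if `p = 3` and `a_3 = ±3` (X8): the typed
residue `Typed.X8.MissingInputAt W 3` (Sprung's ♯/♭ side; rank `0` ∧ surj(3): the ♯/♭ lower bound,
else the whole output). So the §B corner of the strong partial theorem COSTS, cell by cell, one signed
Eisenstein divisibility (r = 0, big image), one signed main conjecture (r = 1), or — only at small image
in rank 0 and on X8 — the typed output itself. Nothing asserted beyond the binders; labels unchanged.
[cite: Kobayashi2003, Thm. 1.2, Thm. 7.4 and Conjecture (p. 2)] [cite: Wuthrich2014, Prop. 21 (p. 400)]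
[cite: BurungaleKobayashiOta2023, App. A Cor. A.5] [cite: BDKim2013, Cor. 3.15 (p. 199)]
[cite: Serre1981, §8.1–8.2 (pp. 188–189)] [cite: Miller2011LMS, §1 and Def. 1.1] -/
theorem bsdp_of_goodSS_of_typedInputs_of_analyticRank_le_one
    (hW : Wuthrich2014.sha_dvd_analyticSha)
    (h12 : Kobayashi2003.thm12_signedSelmerDual_finite_torsion)
    (hKim : BDKim2013.cor315_signedCharValue_rankZero)
    (hPollack : ∀ {N : ℕ} [NeZero N] {f : CuspForm (Gamma0 N) 2},
      pollack_exists_plusMinusPAdicLFunction (W := W) (f := f) (p := p))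
    (hmod : nonempty_modularParametrizationData) (hmod' : hasEntireLFunction_rat)
    (hGZK : rank_eq_analyticRank_of_analyticRank_le_one)
    (hA5 : corA5_pPart_of_signedCharIdeal_eq)
    (hp : p ≠ 2) (hss : GoodSS W p) (hr : W.analyticRank ≤ 1)
    (h0 : W.frobeniusTrace p = 0 → W.analyticRank = 0 → Surj W p →
      ∃ ε : ℤˣ, KobayashiLowerDivisibility W p ε)
    (h0' : W.frobeniusTrace p = 0 → W.analyticRank = 0 → ¬ Surj W p → MissingPPartAt W p)
    (h1 : W.frobeniusTrace p = 0 → W.analyticRank = 1 → ∃ ε : ℤˣ, KobayashiMainConjecture W p ε)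
    (hX8 : p = 3 → W.frobeniusTrace 3 ≠ 0 → X8.MissingInputAt W 3) : BSDp W p := by
  by_cases hap : W.frobeniusTrace p = 0
  · exact bsdp_of_goodSS_apZero_of_signedInputs_of_analyticRank_le_one W p hW h12 hKim hPollack hmod hmod'
      hGZK hA5 hp hss.1 hap hr (h0 hap) (h0' hap) (h1 hap)
  · -- `a_p ≠ 0` at an odd supersingular prime forces `p = 3` (Hasse), i.e. class X8
    have hp3 : p = 3 := by
      by_contra hne
      have hpP : p.Prime := Fact.out
      have h5 : 5 ≤ p := by
        rcases hpP.eq_two_or_odd' with h2 | hodd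
        · exact absurd h2 hp
        · have h3 : p ≠ 3 := hne
          have := hpP.two_le
          rcases hodd with ⟨k, hk⟩
          omega
      exact hap ((W.natCast_dvd_frobeniusTrace_iff_eq_zero p h5 hss.1).mp hss.2)
    subst hp3
    exact X8.bsdp_of_missingInputAt hW hGZK hmod' W 3 hr ⟨rfl, hss, hap⟩ (hX8 rfl hap)

end Summit.BirchSwinnertonDyer.Rank1Residual.Supersingular

end
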